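import Summits.ValiantsHypothesis.ValiantsHypothesis.Theorems.GeneratorObstructionsPerGenDegreeSuperQPModularCollapseCone

/-!
# Route GeneratorObstructions — K1 `PerGenDegreeSuperQP` (stmt-ValiantsHypothesis-11654),
# line `per-side-atoms`: EVERY SHORT CHAMBER RAY `(1^j)^*`, `1 ≤ j ≤ m`, of `S(per_m)` is hit
# and starts with an atom

Conclusion of `…ModularCollapse` / `…ModularCollapseCone`. The modular collapse
`Q_{m,j} = per_m(x_{ik} ↦ y_{(i+k) mod j})` is polystable for `1 ≤ j ≤ m`
(`isPolystable_modCollapse`); placed on the matrix positions `(0, r)`, `r < j`, it is the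
renaming `x_{ik} ↦ x_{0, (i+k) mod j}` of `per_m`, a point of the endomorphism orbit, hence of
`Δ(per_m)` (`rename_modCollapse_mem_orbitClosure_per`); the ray criterion of `…RayCriterion`
(`exists_hasHighestWeight_rectangle_of_isSLSemistable_projection`: a semistable `j`-variable
degeneration hits the rectangular ray `j`) and `exists_least_rectangle_atom` then give:

* `per_ray_hit_of_le` — **for all `1 ≤ j ≤ m` the ray `j` of `S(per_m)` is hit**: `(k^j)^*`
  occurs in `ℂ[Δ_m[per_m]]` for some `k ≥ 1`;
* `per_exists_ray_atom_of_le` — **and carries an ATOM** `(k₀^j)^*`, the first weight on the ray.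

State of the chamber-ray catalogue of the line after this file: hit are ALL `j ≤ m` (this file),
all products `j = r₁ r₂` and sums `j = r + p` of two divisors of `m` (`…BiCollapsedPermanentRays`,
`…TwoMonomialsRay`, `…FermatChowRay`), in particular `m + 1`, `2m`, `m²`; open are the remaining
`m < j < m²` (for `m` prime: `j ∉ {m+1, 2m, m²}`), and — the registered content of `stub_atomLate` —
the first-occurrence DEGREES `k₀(j, m) · j / m` on every ray. Labelled collapses
`x_{ik} ↦ y_{a(i)+b(k)}` cannot reach `j = m² - 1` for `m ≥ 3` (one forced collision; the two
colliding cells would need residue mass `2(m-1)/j ≠ m/j`), so long rays need genuinely linear (not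
monomial) substitutions. Honest framing: unconditional occupancy theorems; `stub_atomLate`
(`c ≥ 2`), K1 and `GenFlipThesis` remain OPEN; nothing here bears on VP versus VNP.
References: [BurgisserIkenmeyer2017] Prop. 2.8 (corrected), Def. 3.3; [MulmuleySohoni2001] §4;
[MumfordFogartyKirwan1994] Ch. 2 §1.
-/

set_option linter.dupNamespace false

noncomputable section

namespace Summit.ValiantsHypothesis.ValiantsHypothesis.Theorems.GeneratorObstructions.PerGenDegreeSuperQP

open MvPolynomial
open Literature.NumberTheory.DiophantineGeometry Literature.Computability.AlgebraicComplexity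
  Literature.Computability.Complexity

section Placement

variable {m j : ℕ} [NeZero m] [NeZero j]

/-- **The modular collapse is a degeneration of the permanent**: placed at the matrix positions
`(0, r)`, `r < j ≤ m`, it is the renaming `x_{ik} ↦ x_{0, (i+k) mod j}` of `per_m`, a point of the
endomorphism orbit, hence of `Δ(per_m)`. [cite: MulmuleySohoni2001, §4] -/
theorem rename_modCollapse_mem_orbitClosure_per (hjm : j ≤ m) :
    MvPolynomial.rename (fun y : Fin j => (toLex ((0 : Fin m), Fin.castLE hjm y) : MatIdx m))
        (MvPolynomial.rename
          (fun ik : Fin m × Fin m => Fin.ofNat j (ik.1 : ℕ) + Fin.ofNat j (ik.2 : ℕ))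
          (perPoly (Fin m) ℂ)) ∈
      orbitClosure (MvPolynomial.rename (toLex : Fin m × Fin m → MatIdx m) (perPoly (Fin m) ℂ)) := by
  haveI : Infinite ℂ := CharZero.infinite ℂ
  have hmem := rename_mem_orbitClosure_of_selfMap
    (fun x : MatIdx m => (toLex ((0 : Fin m),
      Fin.castLE hjm (Fin.ofNat j ((ofLex x).1 : ℕ) + Fin.ofNat j ((ofLex x).2 : ℕ))) : MatIdx m))
    (MvPolynomial.rename (toLex : Fin m × Fin m → MatIdx m) (perPoly (Fin m) ℂ))
  rw [rename_rename] at hmem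
  rw [rename_rename]
  have hfun : ((fun y : Fin j => (toLex ((0 : Fin m), Fin.castLE hjm y) : MatIdx m)) ∘
      (fun ik : Fin m × Fin m => Fin.ofNat j (ik.1 : ℕ) + Fin.ofNat j (ik.2 : ℕ))) =
      ((fun x : MatIdx m => (toLex ((0 : Fin m),
        Fin.castLE hjm (Fin.ofNat j ((ofLex x).1 : ℕ) + Fin.ofNat j ((ofLex x).2 : ℕ))) : MatIdx m)) ∘
        (toLex : Fin m × Fin m → MatIdx m)) := by
    funext ik
    simp only [Function.comp_apply, ofLex_toLex]
  rw [hfun]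
  exact hmem

end Placement

section Rays

variable {m j : ℕ}

/-- **Every short ray is hit.** For all `1 ≤ j ≤ m` the rectangular weight `(k^j)^*` occurs in
`ℂ[Δ_m[per_m]]` for some `k ≥ 1`: the modular collapse `Q_{m,j}` on the first `j` matrix
positions is a polystable, hence `SL_j`-semistable, `j`-variable degeneration of `per_m`; then
the ray criterion. [cite: BurgisserIkenmeyer2017, Prop. 2.8 and Def. 3.3] -/
theorem per_ray_hit_of_le (hj : 0 < j) (hjm : j ≤ m) :
    ∃ k : ℕ, 0 < k ∧
      highestWeightSpace (orbitCoordRep (MvPolynomial.rename toLex (perPoly (Fin m) ℂ)) m)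
        (partitionWeightLex m (Nat.Partition.rectangle j k)) ≠ ⊥ := by
  haveI : NeZero m := ⟨by omega⟩
  haveI : NeZero j := ⟨hj.ne'⟩
  have hm : m ≠ 0 := by omega
  have hκ : Function.Injective
      (fun y : Fin j => (toLex ((0 : Fin m), Fin.castLE hjm y) : MatIdx m)) := by
    intro y y' hyy
    have h' := congrArg (fun x : MatIdx m => ofLex x) hyy
    simp only [ofLex_toLex, Prod.mk.injEq, true_and] at h'
    exact Fin.castLE_injective hjm h'
  obtain ⟨k, hk, hocc⟩ := exists_hasHighestWeight_rectangle_of_isSLSemistable_projection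
    (matIdxEquiv m) hm (perFormLex_isHomogeneous m) hj _ hκ
    (modCollapse_isHomogeneous (m := m) (j := j)) (rename_modCollapse_mem_orbitClosure_per hjm)
    ((isPolystable_modCollapse hj hjm).isSLSemistable modCollapse_ne_zero)
  exact ⟨k, hk, hocc⟩

/-- **Every short ray carries an atom.** For all `1 ≤ j ≤ m`, `S(per_m)` has an ATOM
`(k₀^j)^*`, `k₀ ≥ 1`: the first weight on the rectangular ray `j` occurs and admits no splitting
into two nonzero occurring weights (facial-ray principle, `exists_least_rectangle_atom`).
[cite: BurgisserIkenmeyer2017, Prop. 2.8 and Def. 3.3] -/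
theorem per_exists_ray_atom_of_le (hj : 0 < j) (hjm : j ≤ m) :
    ∃ k₀ : ℕ, 0 < k₀ ∧
      highestWeightSpace (orbitCoordRep (MvPolynomial.rename toLex (perPoly (Fin m) ℂ)) m)
        (partitionWeightLex m (Nat.Partition.rectangle j k₀)) ≠ ⊥ ∧
      (∀ k : ℕ, 0 < k → k < k₀ →
        highestWeightSpace (orbitCoordRep (MvPolynomial.rename toLex (perPoly (Fin m) ℂ)) m)
          (partitionWeightLex m (Nat.Partition.rectangle j k)) = ⊥) ∧
      (∀ χ₁ χ₂ : Weight (MatIdx m),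
        χ₁ + χ₂ = partitionWeightLex m (Nat.Partition.rectangle j k₀) →
        χ₁ ≠ 0 → χ₂ ≠ 0 →
        highestWeightSpace (orbitCoordRep (MvPolynomial.rename toLex (perPoly (Fin m) ℂ)) m) χ₁ = ⊥ ∨
          highestWeightSpace (orbitCoordRep (MvPolynomial.rename toLex (perPoly (Fin m) ℂ)) m) χ₂ = ⊥) :=
  exists_least_rectangle_atom _ _ hj (hjm.trans (Nat.le_mul_self m)) (per_ray_hit_of_le hj hjm)

end Rays

end Summit.ValiantsHypothesis.ValiantsHypothesis.Theorems.GeneratorObstructions.PerGenDegreeSuperQP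

end
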